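import Summits.Parity.GeneralizedHardyLittlewood.Theorems.LeeYangFibresAbsoluteUpgradeUniformDefs
import Summits.Parity.GeneralizedHardyLittlewood.Theorems.LeeYangFibresAbsoluteUpgradeUniformGrowth
import Summits.Parity.GeneralizedHardyLittlewood.Theorems.LeeYangFibresRelativeDimOneSingularMeanGlueAux
import Literature.NumberTheory.LFunctions.MertensElementary
import Literature.NumberTheory.Sieve.HeathBrownCubicNuSum
import Mathlib.NumberTheory.Primorial
import HarnessLib

/-!
# Route `LeeYangFibres`, crux `AbsoluteUpgrade` (stmt-Parity-14116), line `Sketch` (uniform amplification):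
# medium collision moduli, part 2 — the two prime-sum estimates and the junk inequality

Auxiliary file for the registered stub `stub_mediumCollisions` (D1 = `MediumCollisions`, vocabulary
`Theorems/LeeYangFibresAbsoluteUpgradeUniformDefs.lean`). After the per-modulus bound of part 1, the sum over
the square-free collision moduli `∏Q`, `Q ⊆ primes(y, x]`, with weights `∏_{p∈Q} (p − T)⁻¹` splits into

* a MAIN part `∑_{∅ ≠ Q ⊆ W} ∏_{p∈Q} T²/(p(p−T)) = ∏_{p∈W}(1 + T²/(p(p−T))) − 1 ≤ exp(2T²/y) − 1 ≤ 4T²/y`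
  (`sum_powerset_nonempty_prod_le`: all `p ∈ W` exceed `y ≥ max(2T, 2T²)`, `∑_{n > y} n⁻² ≤ 1/y`,
  `∏(1+u) ≤ exp(∑ u)` is the tree's `CubicSieve.prod_one_add_le_exp_sum`);
* an ERROR part `∑_{Q ⊆ W'} ∏_{p∈Q} T²/(p−T) = ∏_{p∈W'}(1 + T²/(p−T)) ≤ exp(2T² ∑_{p ≤ √N} 1/p) ≤ exp(2T²(log log N + 4))`
  (`sum_powerset_prod_le_exp`, Mertens `sum_inv_prime_le`);
* the JUNK inequality `4 m 7^m · primorial(y_N) · exp(2T²(log log N + 4)) ≤ (η/2) N^{3/4}` for all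
  `m ≤ T ≤ (log log N)^A` and all large `N` (`eventually_junk_le`, the registered sub-goal of this file;
  `primorial(y_N) ≤ N^{(log 4)/4} ≤ N^{7/20}` and every other factor is `≤ N^{1/20}` by the `UniformGrowth` toolkit);
* the bookkeeping identity `weights_mul_bound_eq` used to distribute the weights.

References: P. X. Gallagher, Mathematika 23 (1976), §2 [Gallagher1976]; B. Green, T. Tao, Ann. of Math. 171
(2010), Lemma 1.3 [GreenTao2010]; Hardy–Wright Thm 427 (Mertens) [HardyWright2008].
-/

noncomputable section

open scoped BigOperators Classical Topology
open Finset Filter MeasureTheory Literature.NumberTheory.Sieve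
open Summit.Parity.GeneralizedHardyLittlewood.Cruxes.RelativeDimOne.TranslateAmplification

namespace Summit.Parity.GeneralizedHardyLittlewood.Cruxes.AbsoluteUpgrade.UniformAmplification

/-! ### Products `∏ (1 + u)` -/

open CubicSieve (prod_one_add_le_exp_sum)

/-- The sum over the NON-EMPTY subsets: `∑_{∅ ≠ Q ⊆ s} ∏_{i ∈ Q} u_i = ∏_{i ∈ s} (1 + u_i) − 1`. [folklore] -/
theorem sum_powerset_nonempty_prod_eq {ι : Type*} (s : Finset ι) (u : ι → ℝ) :
    ∑ Q ∈ s.powerset.filter (fun Q => Q.Nonempty), ∏ i ∈ Q, u i = ∏ i ∈ s, (1 + u i) - 1 := by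
  rw [Finset.prod_one_add, ← Finset.sum_filter_add_sum_filter_not s.powerset (fun Q => Q.Nonempty)]
  have h : s.powerset.filter (fun Q => ¬ Q.Nonempty) = {∅} := by
    ext Q
    simp only [Finset.mem_filter, Finset.mem_powerset, Finset.not_nonempty_iff_eq_empty,
      Finset.mem_singleton]
    constructor
    · exact fun h => h.2
    · rintro rfl
      exact ⟨Finset.empty_subset _, rfl⟩
  rw [h, Finset.sum_singleton, Finset.prod_empty]
  ring

/-! ### The MAIN part: primes above `y` -/

/-- **MAIN part.** For `W ⊆ (y, x]` with `y ≥ 1`, `y ≥ 2T`, `y ≥ 2T²`: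
`∑_{∅ ≠ Q ⊆ W} ∏_{p∈Q} T²/(p(p−T)) ≤ 4T²/y`
(`T²/(p(p−T)) ≤ 2T²/p²`, `∑_{n > y} n⁻² ≤ 1/y`, `∏(1+u) − 1 ≤ e^s − 1 ≤ 2s` for `s = ∑ u ≤ 1`). [cite: Gallagher1976, Section 2] -/
theorem sum_powerset_nonempty_prod_le (W : Finset ℕ) {y x : ℕ} {T : ℝ} (hy : 1 ≤ y)
    (hW : W ⊆ Finset.Ioc y x) (hyT : 2 * T ≤ y) (hyT2 : 2 * T ^ 2 ≤ y) :
    ∑ Q ∈ W.powerset.filter (fun Q => Q.Nonempty), ∏ p ∈ Q, T ^ 2 / ((p : ℝ) * ((p : ℝ) - T)) ≤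
      4 * T ^ 2 / y := by
  have hy0 : (0 : ℝ) < y := by exact_mod_cast hy
  have hmem : ∀ p ∈ W, (y : ℝ) < p := fun p hp => by exact_mod_cast (Finset.mem_Ioc.mp (hW hp)).1
  have hu0 : ∀ p ∈ W, 0 ≤ T ^ 2 / ((p : ℝ) * ((p : ℝ) - T)) := fun p hp => by
    have h1 := hmem p hp
    have h2 : 0 < (p : ℝ) - T := by linarith
    positivity
  have hule : ∀ p ∈ W, T ^ 2 / ((p : ℝ) * ((p : ℝ) - T)) ≤ 2 * T ^ 2 * ((p : ℝ) ^ 2)⁻¹ := by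
    intro p hp
    have h1 := hmem p hp
    have hp0 : (0 : ℝ) < p := by linarith
    have h2 : (p : ℝ) / 2 ≤ (p : ℝ) - T := by linarith
    have h3 : 0 < (p : ℝ) - T := by linarith
    rw [div_le_iff₀ (by positivity)]
    calc T ^ 2 = 2 * T ^ 2 * ((p : ℝ) ^ 2)⁻¹ * ((p : ℝ) * ((p : ℝ) / 2)) := by
          field_simp
      _ ≤ 2 * T ^ 2 * ((p : ℝ) ^ 2)⁻¹ * ((p : ℝ) * ((p : ℝ) - T)) := by gcongr
  -- `s = ∑ u ≤ 2T²/y ≤ 1`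
  have hs : ∑ p ∈ W, T ^ 2 / ((p : ℝ) * ((p : ℝ) - T)) ≤ 2 * T ^ 2 / y := by
    calc ∑ p ∈ W, T ^ 2 / ((p : ℝ) * ((p : ℝ) - T)) ≤ ∑ p ∈ W, 2 * T ^ 2 * ((p : ℝ) ^ 2)⁻¹ :=
          Finset.sum_le_sum hule
      _ ≤ ∑ n ∈ Finset.Ioc y x, 2 * T ^ 2 * ((n : ℝ) ^ 2)⁻¹ :=
          Finset.sum_le_sum_of_subset_of_nonneg hW fun n _ _ => by positivity
      _ = 2 * T ^ 2 * ∑ n ∈ Finset.Ioc y x, ((n : ℝ) ^ 2)⁻¹ := by rw [Finset.mul_sum]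
      _ ≤ 2 * T ^ 2 * (y : ℝ)⁻¹ :=
          mul_le_mul_of_nonneg_left (sum_Ioc_inv_sq_le hy x) (by positivity)
      _ = 2 * T ^ 2 / y := by rw [div_eq_mul_inv]
  have hs0 : 0 ≤ ∑ p ∈ W, T ^ 2 / ((p : ℝ) * ((p : ℝ) - T)) := Finset.sum_nonneg hu0
  have hs1 : ∑ p ∈ W, T ^ 2 / ((p : ℝ) * ((p : ℝ) - T)) ≤ 1 := by
    refine hs.trans ?_
    rw [div_le_one hy0]
    exact hyT2
  rw [sum_powerset_nonempty_prod_eq]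
  have hexp := Real.abs_exp_sub_one_le (x := ∑ p ∈ W, T ^ 2 / ((p : ℝ) * ((p : ℝ) - T)))
    (by rwa [abs_of_nonneg hs0])
  rw [abs_of_nonneg hs0] at hexp
  have h1 := (abs_le.mp hexp).2
  have h2 := prod_one_add_le_exp_sum W _ hu0
  calc ∏ p ∈ W, (1 + T ^ 2 / ((p : ℝ) * ((p : ℝ) - T))) - 1
      ≤ 2 * ∑ p ∈ W, T ^ 2 / ((p : ℝ) * ((p : ℝ) - T)) := by linarith
    _ ≤ 2 * (2 * T ^ 2 / y) := by linarith
    _ = 4 * T ^ 2 / y := by ring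

/-! ### The ERROR part: primes below `√N` (Mertens) -/

/-- **ERROR part.** For `W' ⊆ primes ≤ M`, `2 ≤ M ≤ N`, every `p ∈ W'` at least `2T` (`T ≥ 0`):
`∑_{Q ⊆ W'} ∏_{p∈Q} T²/(p−T) = ∏_{p ∈ W'} (1 + T²/(p−T)) ≤ exp(2T² ∑_{p ≤ M} 1/p) ≤ exp(2T² (log log N + 4))`
(Mertens: `∑_{p ≤ M} 1/p ≤ log log M + 4`). [cite: HardyWright2008, Thm 427] -/
theorem sum_powerset_prod_le_exp (W' : Finset ℕ) {M N : ℕ} {T : ℝ} (hT : 0 ≤ T)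
    (hW : W' ⊆ Nat.primesLE M) (h2T : ∀ p ∈ W', 2 * T < p) (hM : 2 ≤ M) (hMN : M ≤ N) :
    ∑ Q ∈ W'.powerset, ∏ p ∈ Q, T ^ 2 / ((p : ℝ) - T) ≤
      Real.exp (2 * T ^ 2 * (Real.log (Real.log N) + 4)) := by
  have hv0 : ∀ p ∈ W', 0 ≤ T ^ 2 / ((p : ℝ) - T) := fun p hp => by
    have h1 := h2T p hp
    have : 0 < (p : ℝ) - T := by nlinarith
    positivity
  have hvle : ∀ p ∈ W', T ^ 2 / ((p : ℝ) - T) ≤ 2 * T ^ 2 * (1 / (p : ℝ)) := by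
    intro p hp
    have h1 := h2T p hp
    have hp0 : (0 : ℝ) < p := by nlinarith
    have h2 : (p : ℝ) / 2 ≤ (p : ℝ) - T := by linarith
    have h3 : 0 < (p : ℝ) - T := by linarith
    rw [div_le_iff₀ h3]
    calc T ^ 2 = 2 * T ^ 2 * (1 / (p : ℝ)) * ((p : ℝ) / 2) := by field_simp
      _ ≤ 2 * T ^ 2 * (1 / (p : ℝ)) * ((p : ℝ) - T) := by gcongr
  rw [← Finset.prod_one_add]
  refine (prod_one_add_le_exp_sum W' _ hv0).trans (Real.exp_le_exp.mpr ?_)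
  have hM0 : (0 : ℝ) < Real.log M := Real.log_pos (by exact_mod_cast hM)
  have hlog : Real.log (Real.log M) ≤ Real.log (Real.log N) :=
    Real.log_le_log hM0 (Real.log_le_log (by positivity) (by exact_mod_cast hMN))
  calc ∑ p ∈ W', T ^ 2 / ((p : ℝ) - T) ≤ ∑ p ∈ W', 2 * T ^ 2 * (1 / (p : ℝ)) := Finset.sum_le_sum hvle
    _ ≤ ∑ p ∈ Nat.primesLE M, 2 * T ^ 2 * (1 / (p : ℝ)) :=
        Finset.sum_le_sum_of_subset_of_nonneg hW fun p _ _ => by positivity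
    _ = 2 * T ^ 2 * ∑ p ∈ Nat.primesLE M, 1 / (p : ℝ) := by rw [Finset.mul_sum]
    _ ≤ 2 * T ^ 2 * (Real.log (Real.log M) + 4) :=
        mul_le_mul_of_nonneg_left (Literature.NumberTheory.LFunctions.MertensBound.sum_inv_prime_le M hM)
          (by positivity)
    _ ≤ 2 * T ^ 2 * (Real.log (Real.log N) + 4) := by gcongr

/-- A square-free modulus `∏Q ≤ M` of primes has all its prime factors `≤ M`. [folklore] -/
theorem le_of_prod_le {Q : Finset ℕ} {M : ℕ} (hQ : ∀ p ∈ Q, p.Prime) (hQM : ∏ p ∈ Q, p ≤ M) {p : ℕ}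
    (hp : p ∈ Q) : p ≤ M :=
  (Nat.le_of_dvd (Finset.prod_pos fun q hq => (hQ q hq).pos) (Finset.dvd_prod_of_mem _ hp)).trans hQM

/-! ### Distributing the weights `∏ (p − T)⁻¹` -/

/-- Bookkeeping: `(∏_{p∈Q} (p−T)⁻¹) · T^{2#Q} · (F W/∏Q + E) = F W ∏_{p∈Q} T²/(p(p−T)) + E ∏_{p∈Q} T²/(p−T)`.
[folklore] -/
theorem weights_mul_bound_eq (Q : Finset ℕ) (T F Wb E : ℝ) (hQ : ∀ p ∈ Q, T < p)
    (hQ0 : ∀ p ∈ Q, (0 : ℝ) < p) :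
    (∏ p ∈ Q, ((p : ℝ) - T)⁻¹) * (T ^ (2 * #Q) * (F / (∏ p ∈ Q, (p : ℝ)) * Wb + E)) =
      F * Wb * ∏ p ∈ Q, T ^ 2 / ((p : ℝ) * ((p : ℝ) - T)) + E * ∏ p ∈ Q, T ^ 2 / ((p : ℝ) - T) := by
  have hA : ∏ p ∈ Q, ((p : ℝ) - T) ≠ 0 :=
    Finset.prod_ne_zero_iff.mpr fun p hp => by linarith [hQ p hp]
  have hB : ∏ p ∈ Q, (p : ℝ) ≠ 0 := Finset.prod_ne_zero_iff.mpr fun p hp => (hQ0 p hp).ne'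
  rw [pow_mul, Finset.prod_div_distrib, Finset.prod_div_distrib, Finset.prod_mul_distrib,
    Finset.prod_const, Finset.prod_inv_distrib]
  field_simp

/-! ### The junk inequality -/

/-- `log 4 / 4 ≤ 7/20` (`log 2 < 0.6931471808`). [folklore] -/
theorem log_four_div_four_le : Real.log 4 / 4 ≤ (7 / 20 : ℝ) := by
  have h : Real.log 4 = 2 * Real.log 2 := by
    rw [show (4 : ℝ) = 2 ^ 2 by norm_num, Real.log_pow]
    norm_num
  rw [h]
  linarith [Real.log_two_lt_d9]

/-- `primorial(y_N) ≤ N^{7/20}` for `N ≥ 1`. [folklore] -/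
theorem primorial_truncLevel_le_rpow' {N : ℕ} (hN : 1 ≤ N) :
    ((primorial (truncLevel N) : ℕ) : ℝ) ≤ (N : ℝ) ^ (7 / 20 : ℝ) :=
  (primorial_truncLevel_le_rpow hN).trans
    (Real.rpow_le_rpow_of_exponent_le (by exact_mod_cast hN) log_four_div_four_le)

/-- `exp(2T²(log log N + 4)) = (log N)^{2T²} · (e^8)^{T²}` for `log N > 0`. [folklore] -/
theorem exp_two_mul_sq_mul_eq (T : ℕ) {N : ℕ} (hN : 0 < Real.log N) :
    Real.exp (2 * (T : ℝ) ^ 2 * (Real.log (Real.log N) + 4)) =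
      Real.log N ^ (2 * T ^ 2) * Real.exp 8 ^ (T ^ 2) := by
  rw [← Real.exp_log (pow_pos hN (2 * T ^ 2)), Real.log_pow, ← Real.exp_nat_mul, ← Real.exp_add]
  congr 1
  push_cast
  ring

/-- **`eventually_junk_le`** (registered sub-goal of this auxiliary file): for every `A` and `η > 0`, for all large
`N`, every `m ≤ T ≤ (log log N)^A` satisfies
`4 m 7^m · primorial(y_N) · exp(2T²(log log N + 4)) ≤ (η/2) N^{3/4}`
(`m, 7^m, (log N)^{2T²}, e^{8T²} ≤ N^{1/20}` by the `UniformGrowth` toolkit, `primorial(y_N) ≤ N^{7/20}`, and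
`4 N^{11/20} ≤ (η/2) N^{3/4}` once `N^{1/5} ≥ 8/η`). [folklore] -/
theorem eventually_junk_le : ∀ (A : ℕ) (η : ℝ), 0 < η → ∀ᶠ N : ℕ in atTop, ∀ m T : ℕ, (m : ℝ) ≤ T → (T : ℝ) ≤ Real.log (Real.log N) ^ A → 4 * (m : ℝ) * 7 ^ m * primorial (truncLevel N) * Real.exp (2 * (T : ℝ) ^ 2 * (Real.log (Real.log N) + 4)) ≤ η / 2 * (N : ℝ) ^ (3 / 4 : ℝ) := by
  intro A η hη
  have hδ : (0 : ℝ) < 1 / 20 := by norm_num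
  filter_upwards [eventually_natCast_pow_le_rpow A 1 1 hδ,
    eventually_pow_le_rpow A (show (1 : ℝ) ≤ 7 by norm_num) 1 hδ,
    eventually_log_pow_le_rpow (2 * A) 2 hδ,
    eventually_pow_le_rpow (2 * A) (show (1 : ℝ) ≤ Real.exp 8 from Real.one_le_exp (by norm_num)) 1 hδ,
    eventually_le_loglog 0, eventually_log_pos, eventually_ge_atTop 1,
    ((tendsto_rpow_atTop (show (0 : ℝ) < 1 / 5 by norm_num)).comp
      tendsto_natCast_atTop_atTop).eventually_ge_atTop (8 / η)] with N h1 h2 h3 h4 hll hlog hN1 h5 m T hmT hT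
  have hN0 : (0 : ℝ) < N := by exact_mod_cast hN1
  have hTA : (T : ℝ) ≤ 1 * Real.log (Real.log N) ^ A := by rwa [one_mul]
  have hmA : (m : ℝ) ≤ 1 * Real.log (Real.log N) ^ A := hmT.trans hTA
  have hT2' : (T : ℝ) ^ 2 ≤ Real.log (Real.log N) ^ (2 * A) := by
    rw [pow_mul']
    exact pow_le_pow_left₀ (Nat.cast_nonneg T) hT 2
  have hT2 : ((T ^ 2 : ℕ) : ℝ) ≤ 1 * Real.log (Real.log N) ^ (2 * A) := by
    rw [one_mul, Nat.cast_pow]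
    exact hT2'
  have h2T2 : ((2 * T ^ 2 : ℕ) : ℝ) ≤ 2 * Real.log (Real.log N) ^ (2 * A) := by
    push_cast
    linarith
  -- the five factors
  have hm : (m : ℝ) ≤ (N : ℝ) ^ (1 / 20 : ℝ) := by simpa using h1 m hmA
  have h7 : (7 : ℝ) ^ m ≤ (N : ℝ) ^ (1 / 20 : ℝ) := h2 m hmA
  have hP : ((primorial (truncLevel N) : ℕ) : ℝ) ≤ (N : ℝ) ^ (7 / 20 : ℝ) := primorial_truncLevel_le_rpow' hN1
  have hL : Real.log N ^ (2 * T ^ 2) ≤ (N : ℝ) ^ (1 / 20 : ℝ) := h3 (2 * T ^ 2) h2T2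
  have hE : Real.exp 8 ^ (T ^ 2) ≤ (N : ℝ) ^ (1 / 20 : ℝ) := h4 (T ^ 2) hT2
  have h5' : 8 / η ≤ (N : ℝ) ^ (1 / 5 : ℝ) := by simpa using h5
  rw [exp_two_mul_sq_mul_eq T hlog]
  have hX : (N : ℝ) ^ (1 / 20 : ℝ) * (N : ℝ) ^ (1 / 20 : ℝ) * (N : ℝ) ^ (7 / 20 : ℝ) *
      ((N : ℝ) ^ (1 / 20 : ℝ) * (N : ℝ) ^ (1 / 20 : ℝ)) = (N : ℝ) ^ (11 / 20 : ℝ) := by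
    simp only [← Real.rpow_add hN0]
    norm_num
  have h34 : (N : ℝ) ^ (3 / 4 : ℝ) = (N : ℝ) ^ (1 / 5 : ℝ) * (N : ℝ) ^ (11 / 20 : ℝ) := by
    rw [← Real.rpow_add hN0]
    norm_num
  have h11 : 0 ≤ (N : ℝ) ^ (11 / 20 : ℝ) := Real.rpow_nonneg hN0.le _
  calc 4 * (m : ℝ) * 7 ^ m * primorial (truncLevel N) * (Real.log N ^ (2 * T ^ 2) * Real.exp 8 ^ (T ^ 2))
      ≤ 4 * (N : ℝ) ^ (1 / 20 : ℝ) * (N : ℝ) ^ (1 / 20 : ℝ) * (N : ℝ) ^ (7 / 20 : ℝ) *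
          ((N : ℝ) ^ (1 / 20 : ℝ) * (N : ℝ) ^ (1 / 20 : ℝ)) := by
        gcongr
    _ = 4 * (N : ℝ) ^ (11 / 20 : ℝ) := by rw [← hX]; ring
    _ ≤ η / 2 * (8 / η) * (N : ℝ) ^ (11 / 20 : ℝ) := by
        refine mul_le_mul_of_nonneg_right (le_of_eq ?_) h11
        field_simp
        ring
    _ ≤ η / 2 * (N : ℝ) ^ (1 / 5 : ℝ) * (N : ℝ) ^ (11 / 20 : ℝ) := by gcongr
    _ = η / 2 * (N : ℝ) ^ (3 / 4 : ℝ) := by rw [h34]; ring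

end Summit.Parity.GeneralizedHardyLittlewood.Cruxes.AbsoluteUpgrade.UniformAmplification

end
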